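import Summits.ResolutionOfSingularities.ResolutionOfSingularities.Theorems.HilbertSamuelEliminationCampaignW42Ridge
import Literature.AlgebraicGeometry.Resolution.BlowupChartRsop
import Literature.AlgebraicGeometry.Resolution.MarkedIdeals
import Literature.RingTheory.HilbertSamuel.InitialFormOfElement
import HarnessLib

/-!
# [OURS · L1 W4.2] The CONFINEMENT half of the informal crux `RidgeConfinement` (stmt-ResolutionOfSingularities-17845)
# at the level of `κ(x′)`-POINTS — campaign s42 of cell res-hironaka (LADDER-RESOLUTION rung L, D-0089); host route
# HilbertSamuelElimination; `--kind definition --supports stmt-ResolutionOfSingularities-17845`; companion of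
# `HilbertSamuelEliminationCampaignW42Ridge.lean` (p465459: `IsNearPoint`, `residueAlgebra`, `RidgeDimMonotone`)

HONEST FRAMING. Everything below is OURS (campaign statements of slot W4.2 «replace the directrix by Giraud's RIDGE in
CJS Thm. 3.14», typed by res-L1-type-o1 in the statement-only lane on res-L1-s42-pv-1's SIGNATURE-PROPOSAL, STATUS
2026-08-27T00:21:42Z) over the TREE's published-mathematics library: Giraud's ridge `F_x(X) = F(𝒪_{X,x})`
(`Resolution.localRidge`, `Resolution.Scheme.ridge`, file `RidgeLocal.lean`, computed in the FIXED minimal generators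
`HilbertSamuel.minGenerators` of `𝔪_x`), the chart algebra of a blowing up (`Resolution.chartRing c j = A[P/c_j]`,
`chartBase`, `chartGen`, file `BlowupChartRsop.lean`), stalk ideals of ideal sheaves (`Resolution.stalkIdeal`), initial
forms of elements (`HilbertSamuel.initialFormsOf`), Hilbert–Samuel functions (`hilbertSamuelFun`, `minimalPrimesCodim`,
`Scheme.hsFun`). NOTHING here is a statement of H. Hironaka's manuscript [Hironaka2017] (slot W4.2 REPLACES the
manuscript's invariant by the Hilbert–Samuel / ridge architecture of Hironaka 1964 – Giraud 1975 – CJS 2020); nothing is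
asserted: every claim-shaped decl is a `def … : Prop`. AI review is weaker than expert review. No `sorry`, no theorem.

## What is typed (and what is not)

The informal crux (route file, stmt-17845) says: «… every x ∈ D and every point x′ of Bl_D(X) over x that is NEAR to x
(H_{X′}(x′) = H_X(x) …), x′ lies in the projective space P(F_x(X)/T_x(D)) ⊆ π⁻¹(x) of Giraud's RIDGE F_x(X) … in EVERY
characteristic and for every residue field». The companion file recorded this half as NOT TYPED for want of the scheme
`ℙ(F_x(X)/T_x(D))`. res-L1-s42-pv-1 (00:21:42Z) observed that the MEMBERSHIP statement needs no such scheme: it is a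
statement about ONE `κ(x′)`-point. Write `A = 𝒪_{X,x}` (noetherian local, residue field `k = κ(x)`, `e = emb.dim`),
`P = 𝓘_{D,x} = (c_1, …, c_k) ⊆ 𝔪_A` for CHOSEN generators `c`, `N_x := T_x(X)/T_x(D)` read with coordinates
`T_1, …, T_k` dual to `c̄_1, …, c̄_k ∈ 𝔪/𝔪²` (so `N_x(κ) ⊆ κ^k`), and let `x′ ∈ Bl_D(X)` lie over `x` with local ring
`L = 𝒪_{X′,x′}`; some `c_j` generates the exceptional ideal `P·L`, and `u_l := c_l / c_j ∈ L` (`c_l = u_l c_j` in `L`).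
THE DIRECTION of `x′` is `ū = (ū_l)_l ∈ κ(x′)^k` (`ū_j = 1`), a point of `ℙ(N_x)(κ(x′)) = π⁻¹(x)`. The tangent vector
`v ∈ T_x(X)(κ) = κ^e` (values `v_i` on the minimal generators `x̄_i`) maps to `(v(c̄_l))_l ∈ N_x(κ)`, where `v(c̄_l)` is
`v` evaluated on ANY degree-one initial form of `c_l` in the `x_i` (all agree: the `x̄_i` are a basis of `𝔪/𝔪²`).
CONFINEMENT AT `x′`: **`ū` lies in the image of `F_x(X)(κ(x′)) → N_x(κ(x′))`** — for the `k`-algebra structure on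
`κ(x′)` induced by `π`. Since `F_x(X)` is a cone (`Scheme.smul_mem_ridge`) and `ū ≠ 0`, this is «`x′ ∈ ℙ(F_x(X)/T_x(D))`»
on `κ(x′)`-points; `T_x(D) ⊆ F_x(X)` (normal flatness makes `C_x(X)` invariant under `T_x(D)`-translations — Giraud;
not used here) is what makes the image the quotient `F_x(X)/T_x(D)` of the informal wording. `Scheme.ridge X x κ` IS
`localRidge (𝒪_{X,x}) κ` (`RidgeLocal.lean`, definitional), so the stalk-level decls below are statements about `F_x(X)`.

* `CampaignW42.IsNearRing A L N` — NEAR for two local rings at level `N`: `H^{(N−ψ(L))}_L = H^{(N−ψ(A))}_A`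
  (`hilbertSamuelFun`, `minimalPrimesCodim`); `IsNearPoint π N x′` of the companion is literally this for the two stalks.
* `CampaignW42.RidgeConfinedAt A c κ ū` — THE POINT-LEVEL MEMBERSHIP: `∃ v ∈ F(A)(κ)` with `v(c̄_l) = ū_l` for all `l`
  (`Resolution.localRidge A κ`; `v(c̄_l)` = `MvPolynomial.aeval v L` for every `L ∈ initialFormsOf (minGenerators A) (c l) 1`).
* `CampaignW42.RidgeConfinesChart A c N` — THE CHART-ALGEBRA FORM (the shape of pv-1's landed hypersurface instance
  `CampaignW42.residue_chartGen_mem_ridge_of_near`, p476869, which is stated for a form `F` over a local base `R` with the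
  ridge of the cone `V(F̄) ⊆ N_x`): for every chart `j`, every prime `𝔴` of `chartRing c j` over `𝔪_A` whose local ring
  `(B_j)_𝔴` is NEAR to `A` at level `N`, the tautological direction `(ē_l)_l ∈ κ(𝔴)^k` is `RidgeConfinedAt`.
* `CampaignW42.RidgeConfinedPoint D π x′` — THE SCHEME-POINT FORM over stalks: for all generators `c` of
  `stalkIdeal D (π x′)`, every `j` and all `u` with `π♯(c_l) = u_l · π♯(c_j)` in `𝒪_{X′,x′}`, the residues `(ū_l)_l` are
  `RidgeConfinedAt` for the algebra structure `κ(π x′) → κ(x′)` of `π` (`ResidueField.map (π.stalkMap x′)`).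
* `CampaignW42RidgeConfines p` — [OURS · L1 W4.2] replaces the role of the FIRST HALF (confinement) of `RidgeConfinement`
  (stmt-17845) in the ROUTE's scope, quantified exactly like the companion's `RidgeDimMonotone p`: every field `k` of
  characteristic `p`, `X` reduced separated of finite type over `k`, `D` permissible (`IdealSheafData.IsPermissible`),
  `π : X′ → X` a blow-up along `D` (`IsBlowup`), `N ≥ dim X`, `x′` over `V(D)` NEAR at level `N` ⟹ `RidgeConfinedPoint D π x′`.
* `CampaignW42RidgeConfinement p := CampaignW42RidgeConfines p ∧ CampaignW42.RidgeDimMonotone p` — the proposed typed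
  SIGNATURE of item stmt-17845 (plan/SIZED-ASK-L.md §S S-s42 «stmt-17845 signature = RidgeConfines p ∧ RidgeDimMonotone p»;
  the perfect-residue-field clause `RidgeDimEqDirDimOfPerfect p` stays a separate sanity rung) — for res-L1-s42-plan-1 /
  CHAIN w42 to register or amend; NOT registered by this file.

## DESIGN POINTS (for res-L1-s42-plan-1, res-L1-s42-pv-1, CHAIN w42, and the OURS lanes)

* (INTR) INTRINSIC blow-up: the chart is `𝒪_{X,x}[P/c_j]` of `X` itself, not of an ambient regular `Z` (pv-1's wording
  «c ⊂ 𝒪_{X,x}»); for `X ⊂ Z` closed the directions agree (`Bl_D X ⊂ Bl_D Z`), and `F_x(X) ⊆ T_x(X) ⊆ T_x(Z)` does not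
  depend on `Z` (`RidgeLocal.lean` docstring). NO quasi-regularity of `c` in `𝒪_{X,x}` is assumed (false in general for a
  permissible centre of a SINGULAR `X`; it holds in the ambient `R = 𝒪_{Z,x}` of pv-1's hypersurface files).
* (GEN) generators: ANY finite family `c` with `(c) = 𝓘_{D,x}` (resp. `c ⊆ 𝔪_A` at the chart level), any chart index `j`
  and any quotients `u` with `c_l = u_l c_j` in `L`; for a blow-up `P·L` is invertible, so such `u` exist iff `c_j`
  generates `P·L`, and then they are unique (`c_j` is `L`-regular) — no uniqueness is stated or needed.
* (COORD) `F(A)` and the values `v(c̄_l)` are BOTH read in the tree's fixed `minGenerators A`; relating them to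
  coordinates adapted to `c` (pv-1's `N_x = Spec k[T_1, …, T_k]`, ridge of the cone `V(F̄)`) is the change-of-generators
  transport of `Ridge.lean` / `TangentConeChangeOfGenerators.lean` — prover's work, flagged by pv-1 («independent of lifts»).
  `initialFormsOf … 1` is quantified UNIVERSALLY (all degree-one initial forms in minimal generators coincide; for `c_l ∉ 𝔪`
  the set is empty and the clause for `l` is void — excluded by the hypotheses `(c) = 𝓘_{D,x}`, `x ∈ V(D)` resp. `c ⊆ 𝔪`).
* (NEAR) as the companion: CJS's `H_X(x) = H^{(φ_X(x))}_{𝒪_{X,x}}`, `φ = N − ψ`, SAME `N ≥ dim X` on `X` and `X′`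
  (`Scheme.hsFun`; `IsNearRing` is its local-ring spelling). pv-1's hypersurface files use the ORDER form of nearness
  (`ord_{x′}` of the strict transform `≥ μ`), equivalent for hypersurface germs by `hilbertFun_hypersurface_eq_iff` (p477853).
* (AFF) affine equality `v(c̄) = ū` rather than proportionality: equivalent because `F(A)(κ)` is stable under `κ`-scalars
  (`Resolution.smul_mem_localRidge`) and `ū_j = 1`.
* (VAC) VACUITY: `CampaignW42RidgeConfines p` is NOT vacuous — permissible blow-ups with near points exist in every
  characteristic (pv-1's `quadric_exists_nearPoint_mem_ridge`, p477366: Hironaka's quadric over `𝔽₂(l,m)` HAS a near point,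
  confined to the ridge of the cone while the directrix is `0` — the statement must hold THERE first, and pv-1's hypersurface
  form of it does); `RidgeConfinedAt` is
  not trivially true (`v` must hit the prescribed non-zero direction `ū`, `ū_j = 1`, so `v = 0` never works) and not
  trivially false (`F(A) = T(A)` for regular `A`). The universe is `u` throughout, as in the companion (`Scheme.{u}`,
  fields `k : Type u`, residue fields of stalks live in `Type u`).

## References

* J. Giraud, *Contact maximal en caractéristique positive*, Ann. Sci. ÉNS (4) 8 (1975), §1.5, Cor. 2.4, §3.3.1. [Giraud1975]
* V. Cossart, U. Jannsen, S. Saito, *Desingularization: Invariants and Strategy*, LNM 2270 (2020), Def. 2.28, Def. 3.1,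
  Thm. 3.10, Thm. 3.14, Rem. 18.29. [CossartJannsenSaito2020]
* res-L1-s42-pv-1: `…CampaignW42RidgeConfinementHypersurface` (p473864), `…RidgeConfinementLocal` (p476869),
  `…RidgeConfinementQuadric` (p477366), `…NearMultiplicity` (p477853) — the hypersurface INSTANCES this shape abstracts.
* plan/SIZED-ASK-L.md v0.2 §S S-s42; route file Theses/HilbertSamuelElimination.lean (item 17845 docstring).
-/

noncomputable section

set_option linter.dupNamespace false -- mandated namespace of this single-conjunct summit

open CategoryTheory AlgebraicGeometry TopologicalSpace IsLocalRing

namespace Summit.ResolutionOfSingularities.ResolutionOfSingularities.Theorems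

universe u

namespace CampaignW42

open Literature.AlgebraicGeometry.Resolution Literature.RingTheory.HilbertSamuel

/-! ## Local rings: nearness and the point-level membership -/

section LocalRings

/-- [OURS · L1 W4.2] NEAR for two local rings at level `N` (CJS Def. 2.28 read on local rings, as the companion's
`IsNearPoint` reads it on stalks): the Hilbert–Samuel functions `H^{(N − ψ)}` agree,
`hilbertSamuelFun L (N − ψ(L)) = hilbertSamuelFun A (N − ψ(A))`, `ψ = minimalPrimesCodim`. For `A = 𝒪_{X,x}`,
`L = 𝒪_{X′,x′}` this is `IsNearPoint π N x′` verbatim (`Scheme.hsFun`). OURS rendering of a notion of CJS 2020; NOT a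
statement of the manuscript. [folklore] -/
def IsNearRing (A : Type u) [CommRing A] [IsLocalRing A] (L : Type u) [CommRing L] [IsLocalRing L] (N : ℕ) : Prop :=
  hilbertSamuelFun L (N - minimalPrimesCodim L) = hilbertSamuelFun A (N - minimalPrimesCodim A)

variable (A : Type u) [CommRing A] [IsLocalRing A] [IsNoetherianRing A]

/-- [OURS · L1 W4.2] THE POINT-LEVEL MEMBERSHIP «the direction `ū ∈ N_x(κ) ⊆ κ^k` lies in the image of
`F(A)(κ) → N_x(κ)`»: for the noetherian local ring `A` (= `𝒪_{X,x}`, residue field `k`), elements `c_1, …, c_k ∈ A`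
(generators of the centre's ideal), a `k`-algebra `κ` (= `κ(x′)`) and a vector `ū : Fin k → κ`, there is a `κ`-point `v`
of Giraud's ridge `F(A)` (`Resolution.localRidge A κ`, in the fixed minimal generators of `𝔪_A`) whose value on the class
`c̄_l ∈ 𝔪/𝔪²` — `MvPolynomial.aeval v L` for every degree-one initial form `L` of `c_l` (`initialFormsOf (minGenerators A)
(c l) 1`; they all agree) — is `ū_l`, for every `l`. NOT a statement of the manuscript. [folklore] -/
def RidgeConfinedAt {k : ℕ} (c : Fin k → A) (κ : Type u) [CommRing κ] [Algebra (ResidueField A) κ]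
    (ubar : Fin k → κ) : Prop :=
  ∃ v ∈ localRidge A κ, ∀ (l : Fin k) (L : MvPolynomial (Fin (maximalIdeal A).spanFinrank) (ResidueField A)),
    L ∈ initialFormsOf (minGenerators A) (c l) 1 → MvPolynomial.aeval v L = ubar l

/-- [OURS · L1 W4.2] THE CHART-ALGEBRA FORM of confinement at level `N` — the shape that res-L1-s42-pv-1's hypersurface
instance `residue_chartGen_mem_ridge_of_near` (p476869) has, over the INTRINSIC chart `B_j = A[P/c_j]`
(`Resolution.chartRing c j`) of the blow-up of `Spec A`, `A = 𝒪_{X,x}`, along `P = (c_1, …, c_k) ⊆ 𝔪_A`: for every chart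
`j`, every prime `𝔴` of `B_j` lying over `𝔪_A` (hypothesis `hπ`, literally pv-1's: `κ(𝔴)` is then a `k`-algebra through
`Ideal.Quotient.lift`) such that the local ring `(B_j)_𝔴` is NEAR to `A` at level `N`, the tautological direction
`(ē_l)_l ∈ κ(𝔴)^k` (`ē_j = 1`) is `RidgeConfinedAt`. NOT a statement of the manuscript. [folklore] -/
def RidgeConfinesChart {k : ℕ} (c : Fin k → A) (N : ℕ) : Prop :=
  ∀ (j : Fin k) (𝔴 : Ideal (chartRing c j)) [𝔴.IsPrime]
    (hπ : ∀ r ∈ maximalIdeal A,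
      ((algebraMap (chartRing c j) (Ideal.ResidueField 𝔴)).comp (chartBase c j)) r = 0),
    IsNearRing A (Localization.AtPrime 𝔴) N →
      letI : Algebra (ResidueField A) (Ideal.ResidueField 𝔴) :=
        (Ideal.Quotient.lift (maximalIdeal A)
          ((algebraMap (chartRing c j) (Ideal.ResidueField 𝔴)).comp (chartBase c j)) hπ).toAlgebra
      RidgeConfinedAt A c (Ideal.ResidueField 𝔴)
        (fun l : Fin k =>
          (algebraMap (chartRing c j) (Ideal.ResidueField 𝔴) : chartRing c j →+* Ideal.ResidueField 𝔴)
            (chartGen c j l))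

end LocalRings

/-! ## Schemes: confinement at a point of a blow-up, and the route-scope statement -/

section Schemes

variable {X X' : Scheme.{u}}

/-- [OURS · L1 W4.2] CONFINEMENT AT THE POINT `x′` OF `X′` over `x = π x′`, for the ideal sheaf `D` of the centre, read
on stalks: for every finite family `c` of generators of the stalk ideal `𝓘_{D,x} = stalkIdeal D x ⊆ 𝒪_{X,x}`, every index
`j` and every family `u` in `𝒪_{X′,x′}` with `π♯(c_l) = u_l · π♯(c_j)` for all `l` (the chart through `x′`: `c_j`
generates the exceptional ideal; DESIGN POINT (GEN)), the residues `(ū_l)_l ∈ κ(x′)^k` are `RidgeConfinedAt` for the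
`κ(x)`-algebra structure on `κ(x′)` induced by `π` (`ResidueField.map (π.stalkMap x′)`). NOT a statement of the
manuscript. [folklore] -/
def RidgeConfinedPoint [IsLocallyNoetherian X] (D : X.IdealSheafData) (π : X' ⟶ X) (x' : X') : Prop :=
  ∀ (k : ℕ) (c : Fin k → X.presheaf.stalk (π.base x')),
    Ideal.span (Set.range c) = stalkIdeal D (π.base x') →
    ∀ (j : Fin k) (u : Fin k → X'.presheaf.stalk x'),
      (∀ l, (π.stalkMap x').hom (c l) = u l * (π.stalkMap x').hom (c j)) →
        letI : Algebra (ResidueField (X.presheaf.stalk (π.base x'))) (ResidueField (X'.presheaf.stalk x')) :=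
          (ResidueField.map (π.stalkMap x').hom).toAlgebra
        RidgeConfinedAt (X.presheaf.stalk (π.base x')) c (ResidueField (X'.presheaf.stalk x'))
          (fun l => residue (X'.presheaf.stalk x') (u l))

end Schemes

end CampaignW42

open Literature.AlgebraicGeometry.Resolution in
/-- [OURS · L1 W4.2] replaces the role of the FIRST HALF (CONFINEMENT: «x′ lies in the projective space P(F_x(X)/T_x(D)) ⊆
π⁻¹(x) of Giraud's RIDGE … in EVERY characteristic and for every residue field») of the informal crux `RidgeConfinement`
(stmt-ResolutionOfSingularities-17845, route HilbertSamuelElimination), at the level of `κ(x′)`-points; NOT a statement of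
the manuscript. In characteristic `p`: for every field `k` of characteristic `p`, every reduced separated scheme `X` of
finite type over `k`, every permissible centre `V(D) ⊆ X` (CJS Def. 3.1, tree `IdealSheafData.IsPermissible`), every
blow-up `π : X′ → X` along `D` (tree `IsBlowup`), every `N ≥ dim X`, and every point `x′` of `X′` over `V(D)` that is NEAR
to `π x′` at level `N` (`CampaignW42.IsNearPoint`): `CampaignW42.RidgeConfinedPoint D π x′`. Giraud 1975 Cor. 2.4 / CJS
2020 Rem. 18.29 (1) in print (orientation; a campaign statement to prove, not a cited fact). VACUITY: module docstring
(VAC) — near points over permissible centres exist (Hironaka's quadric, p477366). [folklore] -/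
def CampaignW42RidgeConfines (p : ℕ) : Prop :=
  ∀ (k : Type u) [Field k] [CharP k p] (X : Scheme.{u}) [IsLocallyNoetherian X] (f : X ⟶ Spec (.of k)),
    IsSeparated f → LocallyOfFiniteType f → QuasiCompact f → IsReduced X →
    ∀ (D : X.IdealSheafData), IdealSheafData.IsPermissible D →
    ∀ (X' : Scheme.{u}) [IsLocallyNoetherian X'] (π : X' ⟶ X), IsBlowup π D →
    ∀ (N : ℕ), topologicalKrullDim X ≤ (N : WithBot ℕ∞) →
    ∀ (x' : X'), π.base x' ∈ D.support → CampaignW42.IsNearPoint π N x' → CampaignW42.RidgeConfinedPoint D π x'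

/-- [OURS · L1 W4.2] the proposed TYPED SIGNATURE of item stmt-ResolutionOfSingularities-17845 (plan/SIZED-ASK-L.md §S S-s42:
«RidgeConfines p ∧ RidgeDimMonotone p»): confinement of near points to the ridge AND monotonicity of the ridge dimension,
in characteristic `p`, route scope. Replaces the role of the informal crux `RidgeConfinement` as a whole (its third
clause «F_red = Dir over perfect residue fields» is the separate sanity rung `CampaignW42.RidgeDimEqDirDimOfPerfect p`);
NOT a statement of the manuscript; NOT registered as the item's signature by this file (planner's verb). [folklore] -/
def CampaignW42RidgeConfinement (p : ℕ) : Prop :=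
  CampaignW42RidgeConfines.{u} p ∧ CampaignW42.RidgeDimMonotone.{u} p

end Summit.ResolutionOfSingularities.ResolutionOfSingularities.Theorems

end
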